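import Summits.QuantumFields.YangMills.Theorems.TransportPerturbationDoeblinCoupling
import Summits.QuantumFields.YangMills.Theorems.ColdStartUniversalityLatticeLangevinDoeblinHaar
import Summits.QuantumFields.YangMills.Theorems.TransportPerturbationSynchronousShadowMeasurableWdisc
import HarnessLib

/-!
# Route `TransportPerturbation`, LINE 10 «harris_hybrid» (crux K1 `LyapunovContraction`, stmt-QuantumFields-26986): the BC5
# rung `FixedCutoffOverlap` FOR WINDOWS OF LATTICE LENGTH `τ/ε_K ≥ 2` — a measurable Doeblin coupling of the step-`K` SZZ
# transition laws, all pairs of starts, truncated `wd_K`-currency mean `≤ 1 − η_K`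

Helper file (seat `ym-line-csu-p1`, g11, free hands; CSU lead memo g10 §3(b)).  The registered plan-only rung of the line,
`stub_fixedCutoffOverlapRung : FixedCutoffOverlap` (skeleton `harris_hybrid_v3`), asks: at each FIXED cut-off `K`, for every
physical window `τ > 0` and truncation scale `δ > 0`, some `η > 0` such that for every jointly measurable solution family `V` of
the step-`K` SZZ dynamics there is a coupling `(T₃, T₄)` in map form of the two window-`τ/ε_K` transition laws (one auxiliary
probability space, jointly measurable in `(u, v, ω)`, prescribed marginals) with `∫ 1 ∧ wd_K(T₃ u v, T₄ u v)/δ ≤ 1 − η` for ALL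
pairs `(u, v)`.

* ★ `fixedCutoffOverlap_of_two_mul_eps_le` — exactly this, for the windows with `2 ε_K ≤ τ` (lattice time `≥ 2`), with
  `η = c_K²`, `c_K` the explicit Doeblin constant of `doeblin_szz_haar`: the coupling is the map-form Doeblin coupling of
  `…DoeblinCoupling` (reference measure `Haar^{⊗E}`, density `Kernel.rnDeriv`, common fresh sample accepted by both copies
  with probability `≥ c_K²`, on which `wd_K = 0`).
* `discG_self`, `wdisc_self`, `wdisc_nonneg` — the currency vanishes on the diagonal and is non-negative.

What is NOT proved: the rung for SHORT windows `τ < 2 ε_K` (small lattice times), which needs strict positivity of the SU(2)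
heat kernel at small times (the tree has `h_t ≥ 1/2` for `t ≥ 2` only, `half_le_heatKernelSU2`); hence the registered stub is
not claimed.  Vocabulary (`Cfg`, `IsSolFamily`, `wdisc`) is the tree copy of the TP skeletons in
`Cruxes.WeightedAlmostInvariance.SynchronousShadow` (verbatim the same as in `harris_hybrid_v3`).  THEOREMS ONLY, [folklore];
K1 stays HELD/OPEN, no crux or summit is proved; the Yang–Mills mass gap is NOT proved.
-/

set_option autoImplicit false

noncomputable section

namespace Summit.QuantumFields.YangMills.Cruxes.WeightedAlmostInvariance.SynchronousShadow

open MeasureTheory ProbabilityTheory Filter Set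
open scoped NNReal ENNReal BigOperators
open Literature.MathematicalPhysics.QuantumFieldTheory
open Literature.MathematicalPhysics.QuantumFieldTheory.Balaban1983to89
open Literature.MathematicalPhysics.QuantumLattice
open Summit.QuantumFields.YangMills.Theorems

variable (F : T3ContinuumYM3Torus.T3Family)

/-! ## The currency on the diagonal -/

/-- `discG K j u u = 0` (the identity gauge transformation realises distance `0`). [folklore] -/
theorem discG_self (K j : ℕ) (u : Cfg F K) : discG F K j u u = 0 := by
  have hone : GaugeField.gaugeAct (fun _ : Site (F.P K) j => (1 : G2)) (avgField F K j u) = avgField F K j u := by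
    funext b
    simp [GaugeField.gaugeAct]
  refine le_antisymm ?_ (Real.iInf_nonneg fun h => fieldDistAt_nonneg F K j _ _)
  calc discG F K j u u ≤ fieldDistAt F K j (avgField F K j u)
        (GaugeField.gaugeAct (fun _ : Site (F.P K) j => (1 : G2)) (avgField F K j u)) :=
        ciInf_le ⟨0, by rintro _ ⟨h, rfl⟩; exact fieldDistAt_nonneg F K j _ _⟩ _
    _ = 0 := by
        rw [hone]
        unfold fieldDistAt
        simp only [sub_self, norm_zero, Real.iSup_const_zero]

/-- `discG ≥ 0`. [folklore] -/
theorem discG_nonneg (K j : ℕ) (u v : Cfg F K) : 0 ≤ discG F K j u v :=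
  Real.iInf_nonneg fun _ => fieldDistAt_nonneg F K j _ _

/-- `wd_K(u, u) = 0`. [folklore] -/
theorem wdisc_self (K : ℕ) (u : Cfg F K) : wdisc F K u u = 0 := by
  unfold wdisc
  exact Finset.sum_eq_zero fun j _ => by rw [discG_self, mul_zero]

/-- `wd_K ≥ 0`. [folklore] -/
theorem wdisc_nonneg (K : ℕ) (u v : Cfg F K) : 0 ≤ wdisc F K u v := by
  unfold wdisc
  exact Finset.sum_nonneg fun j _ => mul_nonneg (pow_nonneg (inv_nonneg.2 (Nat.cast_nonneg _)) _) (discG_nonneg F K j u v)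

/-- The truncated currency `(u, v) ↦ 1 ∧ wd_K(u,v)/δ` is jointly measurable, valued in `[0, 1]`, and vanishes on the
diagonal. [folklore] -/
theorem trunc_wdisc_props (K : ℕ) {δ : ℝ} (hδ : 0 < δ) :
    Measurable (fun q : Cfg F K × Cfg F K => min 1 (wdisc F K q.1 q.2 / δ)) ∧
      (∀ u v, 0 ≤ min 1 (wdisc F K u v / δ)) ∧ (∀ u v, min 1 (wdisc F K u v / δ) ≤ 1) ∧
      ∀ z, min 1 (wdisc F K z z / δ) = 0 := by
  refine ⟨measurable_const.min ((measurable_wdisc F K).div_const δ), fun u v => ?_, fun u v => min_le_left _ _, fun z => ?_⟩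
  · exact le_min zero_le_one (div_nonneg (wdisc_nonneg F K u v) hδ.le)
  · rw [wdisc_self, zero_div, min_eq_right zero_le_one]

/-! ## The rung for windows of lattice length `≥ 2` -/

/-- ★★ **`FixedCutoffOverlap` for windows with `2 ε_K ≤ τ`.**  At each fixed cut-off `K`, for every physical window length
`τ ≥ 2 ε_K` and every `δ > 0` there is `η > 0` (namely `c_K²`, `c_K` the Doeblin constant of the step-`K` SZZ kernels) such
that for EVERY jointly measurable strong-solution family `V` of the step-`K` dynamics (any probability space, any flat driver)
there is a coupling `(T₃, T₄)` in map form of the window-`τ/ε_K` transition laws — one auxiliary probability space, jointly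
measurable in `(u, v, ω)`, marginals `E f(T₃ u v) = P_{τ/ε_K} f(u)`, `E f(T₄ u v) = P_{τ/ε_K} f(v)` for bounded measurable `f` —
whose truncated currency has mean `∫ 1 ∧ wd_K(T₃ u v, T₄ u v)/δ dP₂ ≤ 1 − η` for ALL pairs `(u, v)`. [folklore] -/
theorem fixedCutoffOverlap_of_two_mul_eps_le (γ : ℝ) (K : ℕ) (τ δ : ℝ) (hτ : 2 * (F.P K).eps ≤ τ) (hδ : 0 < δ) :
    ∃ η : ℝ, 0 < η ∧
      ∀ (Ω : Type) [MeasurableSpace Ω] (P : Measure Ω) [IsProbabilityMeasure P]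
        (W : ℝ≥0 → Ω → (Edge 3 ((F.P K).sitesPerDir 0) × NoiseIdx 2 → ℝ)) (hW : IsFlatBrownian W P)
        (V : Cfg F K → ℝ≥0 → Ω → Cfg F K), IsSolFamily F γ K P W hW V →
        ∃ (Ω₂ : Type) (_ : MeasurableSpace Ω₂) (P₂ : Measure Ω₂) (T₃ T₄ : Cfg F K → Cfg F K → Ω₂ → Cfg F K),
          (IsProbabilityMeasure P₂ ∧ Measurable (fun p : (Cfg F K × Cfg F K) × Ω₂ => T₃ p.1.1 p.1.2 p.2) ∧
            Measurable (fun p : (Cfg F K × Cfg F K) × Ω₂ => T₄ p.1.1 p.1.2 p.2) ∧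
            ∀ f : Cfg F K → ℝ, Measurable f → (∃ M : ℝ, ∀ x, |f x| ≤ M) → ∀ x y,
              (∫ ω, f (T₃ x y ω) ∂P₂) = markovTransition V P (τ / (F.P K).eps).toNNReal f x ∧
              (∫ ω, f (T₄ x y ω) ∂P₂) = markovTransition V P (τ / (F.P K).eps).toNNReal f y) ∧
          ∀ u v, (∫ ω, min 1 (wdisc F K (T₃ u v ω) (T₄ u v ω) / δ) ∂P₂) ≤ 1 - η := by
  classical
  -- the lattice, the coupling constant, the window in lattice units
  haveI := ColdStartUniversality.secondCountableTopology_su2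
  haveI := ColdStartUniversality.borelSpace_config ((F.P K).sitesPerDir 0)
  have hε : 0 < (F.P K).eps := pow_pos (inv_pos.2 (Nat.cast_pos.2 (F.P K).L_pos)) _
  set β' : ℝ := (γ * (F.P K).eps)⁻¹ / 2 with hβ'
  set t : ℝ≥0 := (τ / (F.P K).eps).toNNReal with ht
  have htτ : 2 ≤ τ / (F.P K).eps := by rw [le_div_iff₀ hε]; linarith
  have ht2 : (2 : ℝ) ≤ (t : ℝ) := by rw [ht, Real.coe_toNNReal _ (by linarith)]; exact htτ
  have ht0 : 0 < (t : ℝ) := by linarith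
  set H : Measure (Cfg F K) := Measure.pi fun _ : Edge 3 ((F.P K).sitesPerDir 0) =>
    haarProbability (Matrix.specialUnitaryGroup (Fin 2) ℂ) with hH
  haveI : IsProbabilityMeasure (haarProbability (Matrix.specialUnitaryGroup (Fin 2) ℂ)) := inferInstance
  haveI : IsProbabilityMeasure H := by rw [hH]; infer_instance
  -- THE kernels, the explicit Doeblin constant, the density
  obtain ⟨κ, hκM, -, hreal⟩ := ColdStartUniversality.exists_transitionKernel ((F.P K).sitesPerDir 0) β'
  haveI := hκM
  obtain ⟨c, hc0, hc1, hmin⟩ := ColdStartUniversality.doeblin_szz_haar (L := (F.P K).sitesPerDir 0) β' κ hreal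
  have hmin_t : ∀ z, ENNReal.ofReal c • H ≤ κ t z := fun z => hmin z t ht2
  obtain ⟨p, hp, hrep, hlow⟩ :=
    ColdStartUniversality.exists_density_of_minorization (L := (F.P K).sitesPerDir 0) β' κ hreal ht0 hmin_t
  refine ⟨c ^ 2, by positivity, ?_⟩
  intro Ω mΩ P hP W hW V hV
  -- the solution family at the window time and its laws
  have hVt : Measurable fun q : Cfg F K × Ω => V q.1 t q.2 := hV.2 t
  have hlaw : ∀ x, P.map (fun ω => V x t ω) = H.withDensity (p x) := by
    intro x
    rw [← hrep x, hreal t x Ω P W hW (V x) (hV.1 x).1 (hV.1 x).2]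
  have hminae : ∀ x, ∀ᵐ w ∂H, ENNReal.ofReal c ≤ p x w := hlow
  have hcne : ENNReal.ofReal c ≠ ⊤ := ENNReal.ofReal_ne_top
  have hcle : ENNReal.ofReal c ≤ 1 := by
    rw [← ENNReal.ofReal_one]; exact ENNReal.ofReal_le_ofReal hc1
  obtain ⟨hdm, hd0, hd1, hdd⟩ := trunc_wdisc_props F K hδ
  -- the coupling
  refine ⟨(Ω × Ω) × (Cfg F K × ℝ), inferInstance, (P.prod P).prod (H.prod (volume.restrict (Icc (0 : ℝ) 1))),
    fun x _ ω => if ENNReal.ofReal ω.2.2 * p x (V x t ω.1.1) ≤ ENNReal.ofReal c then ω.2.1 else V x t ω.1.1,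
    fun _ y ω => if ENNReal.ofReal ω.2.2 * p y (V y t ω.1.2) ≤ ENNReal.ofReal c then ω.2.1 else V y t ω.1.2,
    ⟨TransportPerturbation.DoeblinCoupling.isProbabilityMeasure_aux P H,
      TransportPerturbation.DoeblinCoupling.measurable_select₃ (V := fun x ω => V x t ω) hVt hp _,
      TransportPerturbation.DoeblinCoupling.measurable_select₄ (V := fun x ω => V x t ω) hVt hp _,
      fun f hf _ x y => ⟨?_, ?_⟩⟩, fun u v => ?_⟩
  · exact TransportPerturbation.DoeblinCoupling.integral_comp_select₃ P H (V := fun x ω => V x t ω) hVt hp hcne hlaw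
      hminae hf x y
  · exact TransportPerturbation.DoeblinCoupling.integral_comp_select₄ P H (V := fun x ω => V x t ω) hVt hp hcne hlaw
      hminae hf x y
  · have h := TransportPerturbation.DoeblinCoupling.integral_trunc_le P H (V := fun x ω => V x t ω) hVt hp hcle hlaw
      hminae (d := fun u v => min 1 (wdisc F K u v / δ)) hdm hd0 hd1 hdd u v
    rw [ENNReal.toReal_ofReal hc0.le] at h
    exact h

end Summit.QuantumFields.YangMills.Cruxes.WeightedAlmostInvariance.SynchronousShadow

end
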